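import Mathlib

/-!
# Route `FilamentSkeletonRss` · child crux `TangentSkeletonNearStraightL` (stmt-NavierStokesRegularity-23320) · registered line
# `child_tangent_analytic_strip_L` (b0b56c52900dd90a), stub `stub_stripPropagation` — brick: THE PAIR-AVERAGING PRINCIPLE for the complexified chord

The complexified squared chord of a stadium-analytic filament `F : ℂ → ℂ³` along the segment `z + [0,1]·s` factors as
`Q(z,s) = Σᵢ (Fᵢ(z+s) − Fᵢ(z))² = s² · P`, `P = Σᵢ Wᵢ²`, `Wᵢ = ∫₀¹ F′ᵢ(z + r s) dr`, and `P` is a DOUBLE MEAN of pair products: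
`P = ∫₀¹ ∫₀¹ Σᵢ F′ᵢ(z + r s) F′ᵢ(z + r′ s) dr′ dr`.  The landed positivity bricks (`Theorems.StadiumSegmentPositivity.segment_mean_sq_bounds`,
`Theorems.StadiumContourPositivity.pair_chord_re_ge`) bound the pair products by CONSTANTS (sup of the tangent deviations `e`, `q` along the
segment), and with sup-constants the registered quarter-width stadium fails at its output corner by a hair (disc ratio 3:
`(Rb + 2E)²/2 = 1.12 > 1` at `Rb = 1/2`, census of hands leafhand-2-g2 / 7-g0 / 9-g0; my numbers `diag/corner_numbers.out`) although the
same quantity is `0.52` a quarter-width further in.  This file records the averaging principle that lets POINTWISE pair profiles be used: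

* `sum_sq_mean_eq_double_integral` — `Σᵢ Wᵢ² − 1 = ∫₀¹ (∫₀¹ (Σᵢ aᵢ(r) aᵢ(r′) − 1) dr′) dr` for a continuous `a : [0,1] → ℂ³`;
* `sum_sq_mean_sub_one_norm_le_of_pairwise` — `‖Σᵢ aᵢ(r)aᵢ(r′) − 1‖ ≤ φ(r,r′)` (φ jointly continuous) ⇒ `‖Σ Wᵢ² − 1‖ ≤ ∫₀¹∫₀¹ φ`;
* `sum_sq_mean_re_im_of_pairwise` — `1 − φ(r,r′) ≤ Re Σᵢ aᵢ(r)aᵢ(r′)` and `|Im Σᵢ aᵢ(r)aᵢ(r′)| ≤ ψ(r,r′)` ⇒ `1 − ∫∫φ ≤ Re P`, `|Im P| ≤ ∫∫ψ`;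
* `chord_sq_sub_sq_norm_le_of_pairwise`, `chord_sq_re_ge_of_pairwise` — the same transported to the chord of `F` along `z + [0,1]·s`:
  `‖Q − s²‖ ≤ ‖s‖²·∫∫φ` and, for `Re(s²) ≥ 0`, `Re(s²)·(1 − ∫∫φ) − |Im(s²)|·∫∫ψ ≤ Re Q`.
The pair profiles are supplied by the user from the landed pointwise tools (`Theorems.StadiumPairPositivity.re_dot_ge` / `abs_im_dot_le` with the
deviations AT `r` and AT `r′`, or the second-order `Theorems.StadiumChordVariance.norm_sum_mul_sub_one_le`), so that a deviation that is large only
near one end of the segment is paid for only on the corresponding fraction of the square.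

HONEST FRAMING: elementary bricks for a plan about a HYPOTHETICAL filament skeleton on the NEGATIVE side of a MODEL route; the stub
`stub_stripPropagation` is NOT closed by this file; nothing here bears on Navier–Stokes regularity or blow-up.
`--supports stmt-NavierStokesRegularity-23320`.
-/

set_option linter.dupNamespace false

noncomputable section

namespace Summit.NavierStokesRegularity.NavierStokesRegularity.Theorems.StadiumPairAveraging

open Set MeasureTheory
open scoped BigOperators

/-! ## Real and imaginary parts of interval integrals against function bounds -/

/-- `∫₀¹ g ≤ Re ∫₀¹ f` when `g ≤ Re f` pointwise on `[0,1]` (`f`, `g` continuous). [folklore] -/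
theorem integral_le_re_integral_of_le {f : ℝ → ℂ} {g : ℝ → ℝ} (hf : ContinuousOn f (uIcc (0:ℝ) 1))
    (hg : ContinuousOn g (uIcc (0:ℝ) 1)) (h : ∀ r ∈ Icc (0:ℝ) 1, g r ≤ (f r).re) :
    ∫ r in (0:ℝ)..1, g r ≤ (∫ r in (0:ℝ)..1, f r).re := by
  have hre : (∫ r in (0:ℝ)..1, f r).re = ∫ r in (0:ℝ)..1, (f r).re := by
    have h1 := (Complex.reCLM.intervalIntegral_comp_comm (hf.intervalIntegrable (μ := volume)))
    simpa only [Complex.reCLM_apply] using h1.symm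
  rw [hre]
  have hcont : ContinuousOn (fun r => (f r).re) (uIcc (0:ℝ) 1) := Complex.continuous_re.comp_continuousOn hf
  exact intervalIntegral.integral_mono_on (μ := volume) zero_le_one hg.intervalIntegrable hcont.intervalIntegrable
    fun r hr => h r hr

/-- `|Im ∫₀¹ f| ≤ ∫₀¹ g` when `|Im f| ≤ g` pointwise on `[0,1]` (`f`, `g` continuous). [folklore] -/
theorem abs_im_integral_le_integral_of_le {f : ℝ → ℂ} {g : ℝ → ℝ} (hf : ContinuousOn f (uIcc (0:ℝ) 1))
    (hg : ContinuousOn g (uIcc (0:ℝ) 1)) (h : ∀ r ∈ Icc (0:ℝ) 1, |(f r).im| ≤ g r) :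
    |(∫ r in (0:ℝ)..1, f r).im| ≤ ∫ r in (0:ℝ)..1, g r := by
  have him : (∫ r in (0:ℝ)..1, f r).im = ∫ r in (0:ℝ)..1, (f r).im := by
    have h1 := (Complex.imCLM.intervalIntegral_comp_comm (hf.intervalIntegrable (μ := volume)))
    simpa only [Complex.imCLM_apply] using h1.symm
  rw [him]
  have hb : ∀ᵐ r ∂volume, r ∈ Set.Ioc (0:ℝ) 1 → ‖(f r).im‖ ≤ g r :=
    Filter.Eventually.of_forall fun r hr => by
      simpa [Real.norm_eq_abs] using h r (Ioc_subset_Icc_self hr)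
  have h2 := intervalIntegral.norm_integral_le_of_norm_le zero_le_one hb hg.intervalIntegrable
  simpa [Real.norm_eq_abs] using h2

/-- `‖∫₀¹ f‖ ≤ ∫₀¹ g` when `‖f‖ ≤ g` pointwise on `[0,1]` (`g` continuous). [folklore] -/
theorem norm_integral_le_integral_of_le {E : Type*} [NormedAddCommGroup E] [NormedSpace ℝ E] {f : ℝ → E} {g : ℝ → ℝ}
    (hg : ContinuousOn g (uIcc (0:ℝ) 1)) (h : ∀ r ∈ Icc (0:ℝ) 1, ‖f r‖ ≤ g r) :
    ‖∫ r in (0:ℝ)..1, f r‖ ≤ ∫ r in (0:ℝ)..1, g r := by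
  have hb : ∀ᵐ r ∂volume, r ∈ Set.Ioc (0:ℝ) 1 → ‖f r‖ ≤ g r :=
    Filter.Eventually.of_forall fun r hr => h r (Ioc_subset_Icc_self hr)
  exact intervalIntegral.norm_integral_le_of_norm_le zero_le_one hb hg.intervalIntegrable

/-! ## The double mean -/

/-- **The square of the mean is the double mean of pair products.**  For a continuous `a : [0,1] → ℂ³` with means `Wᵢ = ∫₀¹ aᵢ`:
`Σᵢ Wᵢ² − 1 = ∫₀¹ (∫₀¹ (Σᵢ aᵢ(r)·aᵢ(r′) − 1) dr′) dr`, and the inner integral is `Σᵢ aᵢ(r)·Wᵢ − 1`. [folklore] -/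
theorem sum_sq_mean_eq_double_integral {a : ℝ → (Fin 3 → ℂ)} (ha : ContinuousOn a (uIcc (0:ℝ) 1)) :
    (∀ r, ∑ i, a r i * (∫ r' in (0:ℝ)..1, a r' i) - 1 = ∫ r' in (0:ℝ)..1, (∑ i, a r i * a r' i - 1)) ∧
    ∑ i, (∫ r in (0:ℝ)..1, a r i) ^ 2 - 1 =
      ∫ r in (0:ℝ)..1, (∑ i, a r i * (∫ r' in (0:ℝ)..1, a r' i) - 1) := by
  have hai : ∀ i, ContinuousOn (fun r => a r i) (uIcc (0:ℝ) 1) := fun i =>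
    (continuous_apply i).comp_continuousOn ha
  set W : Fin 3 → ℂ := fun i => ∫ r in (0:ℝ)..1, a r i with hW
  have hinner_int : ∀ r, IntervalIntegrable (fun r' => ∑ i, a r i * a r' i) volume (0:ℝ) 1 := fun r =>
    (continuousOn_finsetSum _ fun i _ => (continuousOn_const.mul (hai i))).intervalIntegrable
  have hinner : ∀ r, ∑ i, a r i * W i - 1 = ∫ r' in (0:ℝ)..1, (∑ i, a r i * a r' i - 1) := by
    intro r
    rw [intervalIntegral.integral_sub (hinner_int r) intervalIntegrable_const, intervalIntegral.integral_const]
    simp only [sub_zero, one_smul]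
    congr 1
    rw [intervalIntegral.integral_finsetSum fun i _ => ((hai i).intervalIntegrable.const_mul (a r i))]
    refine Finset.sum_congr rfl fun i _ => ?_
    exact (intervalIntegral.integral_const_mul (a r i) _).symm
  have houter_int : IntervalIntegrable (fun r => ∑ i, a r i * W i) volume (0:ℝ) 1 :=
    (continuousOn_finsetSum _ fun i _ => ((hai i).mul continuousOn_const)).intervalIntegrable
  have houter : ∑ i, W i ^ 2 - 1 = ∫ r in (0:ℝ)..1, (∑ i, a r i * W i - 1) := by
    rw [intervalIntegral.integral_sub houter_int intervalIntegrable_const, intervalIntegral.integral_const]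
    simp only [sub_zero, one_smul]
    congr 1
    rw [intervalIntegral.integral_finsetSum fun i _ => ((hai i).intervalIntegrable.mul_const (W i))]
    refine Finset.sum_congr rfl fun i _ => ?_
    rw [sq]
    exact (intervalIntegral.integral_mul_const (W i) _).symm
  exact ⟨hinner, houter⟩

/-- **Pair averaging, norm form.**  `a : [0,1] → ℂ³` continuous, `φ` jointly continuous with `‖Σᵢ aᵢ(r)aᵢ(r′) − 1‖ ≤ φ(r,r′)` on the
square: then `‖Σᵢ (∫₀¹ aᵢ)² − 1‖ ≤ ∫₀¹∫₀¹ φ`. [folklore] -/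
theorem sum_sq_mean_sub_one_norm_le_of_pairwise {a : ℝ → (Fin 3 → ℂ)} (ha : ContinuousOn a (uIcc (0:ℝ) 1))
    {φ : ℝ → ℝ → ℝ} (hφc : Continuous (Function.uncurry φ))
    (hφ : ∀ r ∈ Icc (0:ℝ) 1, ∀ r' ∈ Icc (0:ℝ) 1, ‖∑ i, a r i * a r' i - 1‖ ≤ φ r r') :
    ‖∑ i, (∫ r in (0:ℝ)..1, a r i) ^ 2 - 1‖ ≤ ∫ r in (0:ℝ)..1, ∫ r' in (0:ℝ)..1, φ r r' := by
  obtain ⟨hinner, houter⟩ := sum_sq_mean_eq_double_integral ha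
  have hφr : ∀ r, Continuous (φ r) := fun r => hφc.comp (Continuous.prodMk_right r)
  have hΦ : Continuous fun r => ∫ r' in (0:ℝ)..1, φ r r' :=
    intervalIntegral.continuous_parametric_intervalIntegral_of_continuous' hφc 0 1
  have hinner_bd : ∀ r ∈ Icc (0:ℝ) 1, ‖∑ i, a r i * (∫ r' in (0:ℝ)..1, a r' i) - 1‖ ≤ ∫ r' in (0:ℝ)..1, φ r r' := by
    intro r hr
    rw [hinner r]
    exact norm_integral_le_integral_of_le (hφr r).continuousOn fun r' hr' => hφ r hr r' hr'
  rw [houter]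
  exact norm_integral_le_integral_of_le hΦ.continuousOn hinner_bd

/-- **Pair averaging, real/imaginary form.**  `a : [0,1] → ℂ³` continuous; `φ`, `ψ` jointly continuous with
`1 − φ(r,r′) ≤ Re Σᵢ aᵢ(r)aᵢ(r′)` and `|Im Σᵢ aᵢ(r)aᵢ(r′)| ≤ ψ(r,r′)` on the square: then `P = Σᵢ (∫₀¹ aᵢ)²` has
`1 − ∫₀¹∫₀¹ φ ≤ Re P` and `|Im P| ≤ ∫₀¹∫₀¹ ψ`. [folklore] -/
theorem sum_sq_mean_re_im_of_pairwise {a : ℝ → (Fin 3 → ℂ)} (ha : ContinuousOn a (uIcc (0:ℝ) 1))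
    {φ ψ : ℝ → ℝ → ℝ} (hφc : Continuous (Function.uncurry φ)) (hψc : Continuous (Function.uncurry ψ))
    (hφ : ∀ r ∈ Icc (0:ℝ) 1, ∀ r' ∈ Icc (0:ℝ) 1, 1 - φ r r' ≤ (∑ i, a r i * a r' i).re)
    (hψ : ∀ r ∈ Icc (0:ℝ) 1, ∀ r' ∈ Icc (0:ℝ) 1, |(∑ i, a r i * a r' i).im| ≤ ψ r r') :
    1 - (∫ r in (0:ℝ)..1, ∫ r' in (0:ℝ)..1, φ r r') ≤ (∑ i, (∫ r in (0:ℝ)..1, a r i) ^ 2).re ∧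
    |(∑ i, (∫ r in (0:ℝ)..1, a r i) ^ 2).im| ≤ ∫ r in (0:ℝ)..1, ∫ r' in (0:ℝ)..1, ψ r r' := by
  have hai : ∀ i, ContinuousOn (fun r => a r i) (uIcc (0:ℝ) 1) := fun i =>
    (continuous_apply i).comp_continuousOn ha
  set W : Fin 3 → ℂ := fun i => ∫ r in (0:ℝ)..1, a r i with hW
  have hφr : ∀ r, Continuous (φ r) := fun r => hφc.comp (Continuous.prodMk_right r)
  have hψr : ∀ r, Continuous (ψ r) := fun r => hψc.comp (Continuous.prodMk_right r)
  have hΦ : Continuous fun r => ∫ r' in (0:ℝ)..1, φ r r' :=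
    intervalIntegral.continuous_parametric_intervalIntegral_of_continuous' hφc 0 1
  have hΨ : Continuous fun r => ∫ r' in (0:ℝ)..1, ψ r r' :=
    intervalIntegral.continuous_parametric_intervalIntegral_of_continuous' hψc 0 1
  -- inner: `Σᵢ aᵢ(r) Wᵢ = ∫ Σᵢ aᵢ(r) aᵢ(r′) dr′`
  have hinner_eq : ∀ r, ∑ i, a r i * W i = ∫ r' in (0:ℝ)..1, ∑ i, a r i * a r' i := by
    intro r
    rw [intervalIntegral.integral_finsetSum fun i _ => ((hai i).intervalIntegrable.const_mul (a r i))]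
    refine Finset.sum_congr rfl fun i _ => ?_
    exact (intervalIntegral.integral_const_mul (a r i) _).symm
  have hinner_cont : ∀ r, ContinuousOn (fun r' => ∑ i, a r i * a r' i) (uIcc (0:ℝ) 1) := fun r =>
    continuousOn_finsetSum _ fun i _ => (continuousOn_const.mul (hai i))
  have hinner : ∀ r ∈ Icc (0:ℝ) 1,
      1 - (∫ r' in (0:ℝ)..1, φ r r') ≤ (∑ i, a r i * W i).re ∧ |(∑ i, a r i * W i).im| ≤ ∫ r' in (0:ℝ)..1, ψ r r' := by
    intro r hr
    rw [hinner_eq r]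
    refine ⟨?_, abs_im_integral_le_integral_of_le (hinner_cont r) (hψr r).continuousOn fun r' hr' => hψ r hr r' hr'⟩
    have h1 := integral_le_re_integral_of_le (hinner_cont r) (continuousOn_const.sub (hφr r).continuousOn)
      (g := fun r' => 1 - φ r r') fun r' hr' => hφ r hr r' hr'
    have h2 : ∫ r' in (0:ℝ)..1, (1 - φ r r') = 1 - ∫ r' in (0:ℝ)..1, φ r r' := by
      rw [intervalIntegral.integral_sub intervalIntegrable_const ((hφr r).intervalIntegrable _ _),
        intervalIntegral.integral_const]
      simp
    rw [h2] at h1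
    exact h1
  -- outer: `P = ∫ Σᵢ aᵢ(r) Wᵢ dr`
  have houter_eq : ∑ i, (W i) ^ 2 = ∫ r in (0:ℝ)..1, ∑ i, a r i * W i := by
    rw [intervalIntegral.integral_finsetSum fun i _ => ((hai i).intervalIntegrable.mul_const (W i))]
    refine Finset.sum_congr rfl fun i _ => ?_
    rw [sq]
    exact (intervalIntegral.integral_mul_const (W i) _).symm
  have houter_cont : ContinuousOn (fun r => ∑ i, a r i * W i) (uIcc (0:ℝ) 1) :=
    continuousOn_finsetSum _ fun i _ => ((hai i).mul continuousOn_const)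
  rw [houter_eq]
  refine ⟨?_, abs_im_integral_le_integral_of_le houter_cont hΨ.continuousOn fun r hr => (hinner r hr).2⟩
  have h1 := integral_le_re_integral_of_le houter_cont (continuousOn_const.sub hΦ.continuousOn)
    (g := fun r => 1 - ∫ r' in (0:ℝ)..1, φ r r') fun r hr => (hinner r hr).1
  have h2 : ∫ r in (0:ℝ)..1, (1 - ∫ r' in (0:ℝ)..1, φ r r') = 1 - ∫ r in (0:ℝ)..1, ∫ r' in (0:ℝ)..1, φ r r' := by
    rw [intervalIntegral.integral_sub intervalIntegrable_const (hΦ.intervalIntegrable _ _),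
      intervalIntegral.integral_const]
    simp
  rw [h2] at h1
  exact h1

/-! ## Transport to the chord of a stadium-analytic filament -/

/-- The tangent sampled along the segment `r ↦ F′(z + r s)` is continuous on `[0,1]` and the chord is `s·(mean tangent)` coordinatewise:
`Fᵢ(z+s) − Fᵢ(z) = s · ∫₀¹ F′ᵢ(z + r s) dr`. [folklore] -/
theorem chord_eq_mul_mean_deriv {U : Set ℂ} (hU : IsOpen U) {F : ℂ → (Fin 3 → ℂ)} (hF : DifferentiableOn ℂ F U)
    {z s : ℂ} (hseg : ∀ r ∈ Set.Icc (0:ℝ) 1, z + (r : ℂ) * s ∈ U) :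
    ContinuousOn (fun r : ℝ => deriv F (z + (r : ℂ) * s)) (uIcc (0:ℝ) 1) ∧
    ∀ i, F (z + s) i - F z i = s * ∫ r in (0:ℝ)..1, deriv F (z + (r : ℂ) * s) i := by
  have hIcc : Set.uIcc (0:ℝ) 1 = Set.Icc 0 1 := uIcc_of_le zero_le_one
  set a : ℝ → (Fin 3 → ℂ) := fun r => deriv F (z + (r : ℂ) * s) with ha
  have hdcont : ContinuousOn (deriv F) U := ((hF.analyticOnNhd hU).deriv).continuousOn
  have hpath_cont : Continuous fun r : ℝ => z + (r : ℂ) * s :=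
    continuous_const.add (Complex.continuous_ofReal.mul continuous_const)
  have ha_cont : ContinuousOn a (uIcc 0 1) := by
    rw [hIcc]; exact hdcont.comp hpath_cont.continuousOn fun r hr => hseg r hr
  have hai_cont : ∀ i, ContinuousOn (fun r => a r i) (uIcc 0 1) := fun i =>
    (continuous_apply i).comp_continuousOn ha_cont
  have hderiv : ∀ r ∈ uIcc (0:ℝ) 1, HasDerivAt (fun r : ℝ => F (z + (r : ℂ) * s)) (s • a r) r := by
    intro r hr
    rw [hIcc] at hr
    have hFd : HasDerivAt F (deriv F (z + (r : ℂ) * s)) (z + (r : ℂ) * s) :=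
      (hF.differentiableAt (hU.mem_nhds (hseg r hr))).hasDerivAt
    have hp : HasDerivAt (fun r : ℝ => z + (r : ℂ) * s) s r := by
      have h1 := (((hasDerivAt_id r).ofReal_comp).mul_const s).const_add z
      simpa using h1
    exact hFd.scomp r hp
  refine ⟨ha_cont, fun i => ?_⟩
  have hci : ∀ r ∈ uIcc (0:ℝ) 1, HasDerivAt (fun r : ℝ => F (z + (r : ℂ) * s) i) (s * a r i) r := by
    intro r hr
    have h := (hasDerivAt_pi.1 (hderiv r hr)) i
    simpa [Pi.smul_apply, smul_eq_mul] using h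
  have hint : IntervalIntegrable (fun r => s * a r i) MeasureTheory.volume 0 1 :=
    ((hai_cont i).intervalIntegrable).const_mul s
  have h := intervalIntegral.integral_eq_sub_of_hasDerivAt hci hint
  rw [intervalIntegral.integral_const_mul] at h
  rw [h]; simp

/-- **Chord, pair-averaged norm form.**  `F : ℂ → ℂ³` complex-differentiable on an open `U`, the segment `z + [0,1]·s ⊆ U`, a jointly continuous
pair profile `φ` with `‖Σᵢ F′ᵢ(z+rs)F′ᵢ(z+r′s) − 1‖ ≤ φ(r,r′)` on the square: `‖Σᵢ (Fᵢ(z+s) − Fᵢ(z))² − s²‖ ≤ ‖s‖²·∫₀¹∫₀¹ φ`. [folklore] -/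
theorem chord_sq_sub_sq_norm_le_of_pairwise {U : Set ℂ} (hU : IsOpen U) {F : ℂ → (Fin 3 → ℂ)} (hF : DifferentiableOn ℂ F U)
    {z s : ℂ} (hseg : ∀ r ∈ Set.Icc (0:ℝ) 1, z + (r : ℂ) * s ∈ U)
    {φ : ℝ → ℝ → ℝ} (hφc : Continuous (Function.uncurry φ))
    (hφ : ∀ r ∈ Icc (0:ℝ) 1, ∀ r' ∈ Icc (0:ℝ) 1,
      ‖∑ i, deriv F (z + (r : ℂ) * s) i * deriv F (z + (r' : ℂ) * s) i - 1‖ ≤ φ r r') :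
    ‖(∑ i, (F (z + s) i - F z i) ^ 2) - s ^ 2‖ ≤ ‖s‖ ^ 2 * ∫ r in (0:ℝ)..1, ∫ r' in (0:ℝ)..1, φ r r' := by
  obtain ⟨ha, hFTC⟩ := chord_eq_mul_mean_deriv hU hF hseg
  have hP := sum_sq_mean_sub_one_norm_le_of_pairwise ha hφc hφ
  have hsum : (∑ i, (F (z + s) i - F z i) ^ 2) - s ^ 2 =
      s ^ 2 * (∑ i, (∫ r in (0:ℝ)..1, deriv F (z + (r : ℂ) * s) i) ^ 2 - 1) := by
    simp only [Fin.sum_univ_three, hFTC]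
    ring
  rw [hsum, norm_mul, norm_pow]
  exact mul_le_mul_of_nonneg_left hP (by positivity)

/-- **Chord, pair-averaged real part.**  `F : ℂ → ℂ³` complex-differentiable on an open `U`, the segment `z + [0,1]·s ⊆ U`, jointly continuous pair
profiles with `1 − φ(r,r′) ≤ Re Σᵢ F′ᵢ(z+rs)F′ᵢ(z+r′s)` and `|Im Σᵢ F′ᵢ(z+rs)F′ᵢ(z+r′s)| ≤ ψ(r,r′)`, and a displacement with `0 ≤ Re(s²)`:
`Re(s²)·(1 − ∫₀¹∫₀¹ φ) − |Im(s²)|·∫₀¹∫₀¹ ψ ≤ Re Σᵢ (Fᵢ(z+s) − Fᵢ(z))²`. [folklore] -/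
theorem chord_sq_re_ge_of_pairwise {U : Set ℂ} (hU : IsOpen U) {F : ℂ → (Fin 3 → ℂ)} (hF : DifferentiableOn ℂ F U)
    {z s : ℂ} (hseg : ∀ r ∈ Set.Icc (0:ℝ) 1, z + (r : ℂ) * s ∈ U)
    {φ ψ : ℝ → ℝ → ℝ} (hφc : Continuous (Function.uncurry φ)) (hψc : Continuous (Function.uncurry ψ))
    (hφ : ∀ r ∈ Icc (0:ℝ) 1, ∀ r' ∈ Icc (0:ℝ) 1,
      1 - φ r r' ≤ (∑ i, deriv F (z + (r : ℂ) * s) i * deriv F (z + (r' : ℂ) * s) i).re)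
    (hψ : ∀ r ∈ Icc (0:ℝ) 1, ∀ r' ∈ Icc (0:ℝ) 1,
      |(∑ i, deriv F (z + (r : ℂ) * s) i * deriv F (z + (r' : ℂ) * s) i).im| ≤ ψ r r')
    (hs : 0 ≤ (s ^ 2).re) :
    (s ^ 2).re * (1 - ∫ r in (0:ℝ)..1, ∫ r' in (0:ℝ)..1, φ r r') -
        |(s ^ 2).im| * (∫ r in (0:ℝ)..1, ∫ r' in (0:ℝ)..1, ψ r r') ≤
      (∑ i, (F (z + s) i - F z i) ^ 2).re := by
  obtain ⟨ha, hFTC⟩ := chord_eq_mul_mean_deriv hU hF hseg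
  obtain ⟨hre, him⟩ := sum_sq_mean_re_im_of_pairwise ha hφc hψc hφ hψ
  set P : ℂ := ∑ i, (∫ r in (0:ℝ)..1, deriv F (z + (r : ℂ) * s) i) ^ 2 with hPdef
  have hsum : (∑ i, (F (z + s) i - F z i) ^ 2) = s ^ 2 * P := by
    simp only [hPdef, Fin.sum_univ_three, hFTC]
    ring
  rw [hsum, Complex.mul_re]
  have hψ0 : 0 ≤ ∫ r in (0:ℝ)..1, ∫ r' in (0:ℝ)..1, ψ r r' := (abs_nonneg _).trans him
  have h1 : (s ^ 2).re * (1 - ∫ r in (0:ℝ)..1, ∫ r' in (0:ℝ)..1, φ r r') ≤ (s ^ 2).re * P.re :=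
    mul_le_mul_of_nonneg_left hre hs
  have h2 : (s ^ 2).im * P.im ≤ |(s ^ 2).im| * ∫ r in (0:ℝ)..1, ∫ r' in (0:ℝ)..1, ψ r r' := by
    calc (s ^ 2).im * P.im ≤ |(s ^ 2).im * P.im| := le_abs_self _
      _ = |(s ^ 2).im| * |P.im| := abs_mul _ _
      _ ≤ |(s ^ 2).im| * ∫ r in (0:ℝ)..1, ∫ r' in (0:ℝ)..1, ψ r r' :=
          mul_le_mul_of_nonneg_left him (abs_nonneg _)
  linarith

/-! ## Appended (same hand): INTEGRABLE pair profiles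

For the corner numerics of the registered quarter width the natural pair profiles are monotone STEP majorants of the transcendental
deviation profiles (Riemann upper sums), which are not continuous.  The averaging principle only needs integrability: the two lemmas below
replace `Continuous (uncurry φ)` by the two interval-integrability facts actually used. -/

/-- **Pair averaging, norm form, integrable profile.**  `a : [0,1] → ℂ³` continuous; `φ` with `r′ ↦ φ r r′` interval-integrable on `[0,1]`
for every `r`, `r ↦ ∫₀¹ φ r r′ dr′` interval-integrable, and `‖Σᵢ aᵢ(r)aᵢ(r′) − 1‖ ≤ φ(r,r′)` on the square: `‖Σᵢ (∫₀¹ aᵢ)² − 1‖ ≤ ∫₀¹∫₀¹ φ`. [folklore] -/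
theorem sum_sq_mean_sub_one_norm_le_of_pairwise_integrable {a : ℝ → (Fin 3 → ℂ)} (ha : ContinuousOn a (uIcc (0:ℝ) 1))
    {φ : ℝ → ℝ → ℝ} (hφi : ∀ r, IntervalIntegrable (φ r) volume (0:ℝ) 1)
    (hΦi : IntervalIntegrable (fun r => ∫ r' in (0:ℝ)..1, φ r r') volume (0:ℝ) 1)
    (hφ : ∀ r ∈ Icc (0:ℝ) 1, ∀ r' ∈ Icc (0:ℝ) 1, ‖∑ i, a r i * a r' i - 1‖ ≤ φ r r') :
    ‖∑ i, (∫ r in (0:ℝ)..1, a r i) ^ 2 - 1‖ ≤ ∫ r in (0:ℝ)..1, ∫ r' in (0:ℝ)..1, φ r r' := by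
  obtain ⟨hinner, houter⟩ := sum_sq_mean_eq_double_integral ha
  have hinner_bd : ∀ r ∈ Icc (0:ℝ) 1, ‖∑ i, a r i * (∫ r' in (0:ℝ)..1, a r' i) - 1‖ ≤ ∫ r' in (0:ℝ)..1, φ r r' := by
    intro r hr
    rw [hinner r]
    have hb : ∀ᵐ r' ∂volume, r' ∈ Set.Ioc (0:ℝ) 1 → ‖∑ i, a r i * a r' i - 1‖ ≤ φ r r' :=
      Filter.Eventually.of_forall fun r' hr' => hφ r hr r' (Ioc_subset_Icc_self hr')
    exact intervalIntegral.norm_integral_le_of_norm_le zero_le_one hb (hφi r)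
  rw [houter]
  have hb : ∀ᵐ r ∂volume, r ∈ Set.Ioc (0:ℝ) 1 →
      ‖∑ i, a r i * (∫ r' in (0:ℝ)..1, a r' i) - 1‖ ≤ ∫ r' in (0:ℝ)..1, φ r r' :=
    Filter.Eventually.of_forall fun r hr => hinner_bd r (Ioc_subset_Icc_self hr)
  exact intervalIntegral.norm_integral_le_of_norm_le zero_le_one hb hΦi

/-- **Pair averaging, real part, integrable profile.**  `a : [0,1] → ℂ³` continuous; `φ` integrable as above with
`1 − φ(r,r′) ≤ Re Σᵢ aᵢ(r)aᵢ(r′)` on the square: `1 − ∫₀¹∫₀¹ φ ≤ Re Σᵢ (∫₀¹ aᵢ)²`. [folklore] -/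
theorem sum_sq_mean_re_ge_of_pairwise_integrable {a : ℝ → (Fin 3 → ℂ)} (ha : ContinuousOn a (uIcc (0:ℝ) 1))
    {φ : ℝ → ℝ → ℝ} (hφi : ∀ r, IntervalIntegrable (φ r) volume (0:ℝ) 1)
    (hΦi : IntervalIntegrable (fun r => ∫ r' in (0:ℝ)..1, φ r r') volume (0:ℝ) 1)
    (hφ : ∀ r ∈ Icc (0:ℝ) 1, ∀ r' ∈ Icc (0:ℝ) 1, 1 - φ r r' ≤ (∑ i, a r i * a r' i).re) :
    1 - (∫ r in (0:ℝ)..1, ∫ r' in (0:ℝ)..1, φ r r') ≤ (∑ i, (∫ r in (0:ℝ)..1, a r i) ^ 2).re := by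
  have hai : ∀ i, ContinuousOn (fun r => a r i) (uIcc (0:ℝ) 1) := fun i =>
    (continuous_apply i).comp_continuousOn ha
  set W : Fin 3 → ℂ := fun i => ∫ r in (0:ℝ)..1, a r i with hW
  have hinner_eq : ∀ r, ∑ i, a r i * W i = ∫ r' in (0:ℝ)..1, ∑ i, a r i * a r' i := by
    intro r
    rw [intervalIntegral.integral_finsetSum fun i _ => ((hai i).intervalIntegrable.const_mul (a r i))]
    refine Finset.sum_congr rfl fun i _ => ?_
    exact (intervalIntegral.integral_const_mul (a r i) _).symm
  have hinner_cont : ∀ r, ContinuousOn (fun r' => ∑ i, a r i * a r' i) (uIcc (0:ℝ) 1) := fun r =>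
    continuousOn_finsetSum _ fun i _ => (continuousOn_const.mul (hai i))
  -- real part of an interval integral against an INTEGRABLE lower bound
  have hre_int : ∀ {f : ℝ → ℂ} {g : ℝ → ℝ}, ContinuousOn f (uIcc (0:ℝ) 1) → IntervalIntegrable g volume (0:ℝ) 1 →
      (∀ r ∈ Icc (0:ℝ) 1, g r ≤ (f r).re) → ∫ r in (0:ℝ)..1, g r ≤ (∫ r in (0:ℝ)..1, f r).re := by
    intro f g hf hg h
    have hre : (∫ r in (0:ℝ)..1, f r).re = ∫ r in (0:ℝ)..1, (f r).re := by
      have h1 := (Complex.reCLM.intervalIntegral_comp_comm (hf.intervalIntegrable (μ := volume)))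
      simpa only [Complex.reCLM_apply] using h1.symm
    rw [hre]
    have hcont : ContinuousOn (fun r => (f r).re) (uIcc (0:ℝ) 1) := Complex.continuous_re.comp_continuousOn hf
    exact intervalIntegral.integral_mono_on (μ := volume) zero_le_one hg hcont.intervalIntegrable fun r hr => h r hr
  have hinner : ∀ r ∈ Icc (0:ℝ) 1, 1 - (∫ r' in (0:ℝ)..1, φ r r') ≤ (∑ i, a r i * W i).re := by
    intro r hr
    rw [hinner_eq r]
    have h1 := hre_int (hinner_cont r) (intervalIntegrable_const.sub (hφi r)) (g := fun r' => 1 - φ r r')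
      fun r' hr' => hφ r hr r' hr'
    have h2 : ∫ r' in (0:ℝ)..1, (1 - φ r r') = 1 - ∫ r' in (0:ℝ)..1, φ r r' := by
      rw [intervalIntegral.integral_sub intervalIntegrable_const (hφi r), intervalIntegral.integral_const]
      simp
    rw [h2] at h1
    exact h1
  have houter_eq : ∑ i, (W i) ^ 2 = ∫ r in (0:ℝ)..1, ∑ i, a r i * W i := by
    rw [intervalIntegral.integral_finsetSum fun i _ => ((hai i).intervalIntegrable.mul_const (W i))]
    refine Finset.sum_congr rfl fun i _ => ?_
    rw [sq]
    exact (intervalIntegral.integral_mul_const (W i) _).symm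
  have houter_cont : ContinuousOn (fun r => ∑ i, a r i * W i) (uIcc (0:ℝ) 1) :=
    continuousOn_finsetSum _ fun i _ => ((hai i).mul continuousOn_const)
  rw [houter_eq]
  have h1 := hre_int houter_cont (intervalIntegrable_const.sub hΦi) (g := fun r => 1 - ∫ r' in (0:ℝ)..1, φ r r')
    fun r hr => hinner r hr
  have h2 : ∫ r in (0:ℝ)..1, (1 - ∫ r' in (0:ℝ)..1, φ r r') = 1 - ∫ r in (0:ℝ)..1, ∫ r' in (0:ℝ)..1, φ r r' := by
    rw [intervalIntegral.integral_sub intervalIntegrable_const hΦi, intervalIntegral.integral_const]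
    simp
  rw [h2] at h1
  exact h1

end Summit.NavierStokesRegularity.NavierStokesRegularity.Theorems.StadiumPairAveraging

end
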